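import Summits.Ventures.LatticeQCDFlow.Scaling.ReplicaExchangeDiffusive
import Summits.Ventures.LatticeQCDFlow.Scaling.ReplicaExchangeBareAcceptance

/-!
HONEST FRAMING: exact (Metropolis-corrected) sampling algorithms for lattice gauge theory; figures
of merit are autocorrelation/cost numbers at stated couplings and volumes; no continuum-physics
claim.

# ReplicaExchangeDiffusiveAcceptance — THE SWAP ACCEPTANCES ENTER THE DIFFUSIVE CEILING LINEARLY: THE EXACT SWAP
# DIRICHLET FORM `𝓔_{Sw}(F) = (2K)⁻¹Σ_jΣ_x min{π̃(x), π̃(x∘σ_j)}(F(x) − F(x∘σ_j))²`, HENCE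
# `Gap ≤ [t/(2K)·Σ_j (a_j − a_{j+1})²·E_j(A) + (1−t)/(K+1)·Σ_k a_k²Q_k(A,Aᶜ)]/Σ_k a_k²μ_k(A)μ_k(Aᶜ)` WITH THE ACCEPTED
# DISAGREEMENT MASS `E_j(A) ≤ min{α_j, D_j(A)}`, AND `Gap ≤ 3tα/(v·K(K+1)(2K+1))` WITH SECTOR-FROZEN COLD REPLICAS
# (lean-2 GEN-19, ours)

Venture-side (OURS).  Cell `lqcd-flow` (pub-lqcd), unit `pub-lqcd-lean-2-g19`, 2026-08-25.  Chapter R, file 12 —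
the refinement of `Scaling/ReplicaExchangeDiffusive` (R10) that keeps the Metropolis acceptance of the swap instead
of bounding it by one.  Setting of R10: the tagless sampler `ptBareSampler t μ M` on `Fin (K+1) → S`, a set of
configurations `A`, the profile count `G_a(x) = Σ_k a_k·f_A^{(μ_k)}(x_k)`.  New quantities (written out, no
definitions): the STATIONARY SWAP ACCEPTANCE `α_j = Σ_x min{π̃(x), π̃(x∘σ_j)}` of the pair `(j, j+1)` — the tree's
`ptFinAcc μ j` of `Scaling/ReplicaExchangeFiniteSampler` — and the ACCEPTED DISAGREEMENT MASS
`E_j(A) = Σ_x min{π̃(x), π̃(x∘σ_j)}·(1_{Aᶜ}(x_j) − 1_{Aᶜ}(x_{j+1}))²`, the stationary rate at which ACCEPTED swaps of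
the pair exchange a configuration in `A` with one outside.

## What is proved

* §1 **`ptBare_dirichletForm_swap_eq`** — for ANY observable, EXACTLY:
  `𝓔_π̃(ptBareSwap μ; F) = (2K)⁻¹·Σ_j Σ_x min{π̃(x), π̃(x∘σ_j)}·(F(x) − F(x∘σ_j))²`;
  **`ptBare_dirichletForm_swap_profileCount_eq`** — `𝓔_{Sw}(G_a) = (2K)⁻¹Σ_j (a_j − a_{j+1})²·E_j(A)`;
  `acceptedDisagreement_le_acc` (`E_j(A) ≤ α_j`), `acceptedDisagreement_le_disagreement` (`E_j(A) ≤ D_j(A)`).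
* §2 **`ptBare_spectralGap_le_profile_acc`** — the profile ceiling of the title;
  **`ptBareLinearAcc_spectralGap_le`** — `a_k = k`, `E_j(A) ≤ e` (all `j`), `μ_k(A)μ_k(Aᶜ) ≥ v > 0` (`k ≥ 1`):
  `Gap ≤ 6·(te/2 + (1−t)/(K+1)·Σ_k k²Q_k(A,Aᶜ))/(v·K(K+1)(2K+1))`;
  **`ptBareFrozenSectorAcc_spectralGap_le`** — no replica at a level `k ≥ 1` crosses the sector and every swap
  acceptance `α_j ≤ α`: `Gap(ptBareSampler t μ M) ≤ 3tα/(v·K(K+1)(2K+1))`, whatever the hot update;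
  **`ptBareFrozenSectorSeparated_spectralGap_le`** — TOO FEW REPLICAS: if every adjacent pair is `ε`-SEPARATED on a
  test set `B_j` (level `j` has mass `≤ ε` in `B_j`, level `j+1` mass `≤ ε` outside it;
  `Scaling/ReplicaExchangeBareAcceptance.ptFinAcc_le_separation`), `Gap ≤ 6tε/(v·K(K+1)(2K+1))`.

Reading (no numerics implied): sector information is carried down the ladder only by ACCEPTED swaps of
DISAGREEING neighbours; per step the pair `(j, j+1)` is tried with probability `t/K` and succeeds at the stationary
rate `E_j(A) ≤ α_j`.  Few replicas over a wide action window make the acceptances small; many replicas make the walk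
long: the relaxation time is at least `v·K(K+1)(2K+1)/(3tα)` sampler steps either way.  NOT CLAIMED: the dependence
of `α_j` on volume and coupling spacing (model input); sharpness; anything measured.  Literature grade (cell rule):
KNOWN MECHANISM (round-trip / acceptance design rules for replica exchange are folklore), NEW TYPING (exact swap
Dirichlet form of the tagless sampler); nothing cited as a fact; no new bib keys.
-/

noncomputable section

open Finset Function
open Literature.Probability.MarkovChains

namespace Summit.Ventures.LatticeQCDFlow.Scaling

variable {S : Type*} [Fintype S] [DecidableEq S] {K : ℕ} {μ : Fin (K + 1) → S → ℝ}
  {M : Fin (K + 1) → S → S → ℝ} {t : ℝ}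

/-! ## §1 The exact swap Dirichlet form -/

/-- **THE EXACT SWAP DIRICHLET FORM of any observable:**
`𝓔_π̃(ptBareSwap μ; F) = (2K)⁻¹·Σ_j Σ_x min{π̃(x), π̃(x∘σ_j)}·(F(x) − F(x∘σ_j))²`. [ours] -/
theorem ptBare_dirichletForm_swap_eq (hμ : ∀ k x, 0 < μ k x) (F : (Fin (K + 1) → S) → ℝ) :
    dirichletForm (tensorFun μ) (ptBareSwap μ) F
      = 1 / (2 * K) * ∑ j : Fin K, ∑ x : Fin (K + 1) → S,
          min (tensorFun μ x) (tensorFun μ (x ∘ levelSwap j)) * (F x - F (x ∘ levelSwap j)) ^ 2 := by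
  have hpt : ∀ x y : Fin (K + 1) → S, tensorFun μ x * ptBareSwap μ x y * (F x - F y) ^ 2
      = ptBareProposal x y * (min (tensorFun μ x) (tensorFun μ y) * (F x - F y) ^ 2) := by
    intro x y
    by_cases hyx : y = x
    · rw [hyx, sub_self]; simp
    · rw [← mul_assoc, tensorFun_mul_ptBareSwap hμ hyx]
  have hrow : ∀ (x : Fin (K + 1) → S) (c : (Fin (K + 1) → S) → ℝ),
      ∑ y, ptBareProposal x y * c y = ∑ j : Fin K, 1 / K * c (x ∘ levelSwap j) := by
    intro x c
    unfold ptBareProposal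
    simp_rw [Finset.sum_mul]
    rw [Finset.sum_comm]
    refine sum_congr rfl fun j _ => ?_
    simp_rw [ite_mul, zero_mul]
    rw [Finset.sum_ite_eq' univ (x ∘ levelSwap j), if_pos (mem_univ _)]
  unfold dirichletForm
  simp_rw [hpt]
  calc 1 / 2 * ∑ x, ∑ y, ptBareProposal x y * (min (tensorFun μ x) (tensorFun μ y) * (F x - F y) ^ 2)
      = 1 / 2 * ∑ x, ∑ j : Fin K, 1 / K
          * (min (tensorFun μ x) (tensorFun μ (x ∘ levelSwap j)) * (F x - F (x ∘ levelSwap j)) ^ 2) := by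
        congr 1
        exact sum_congr rfl fun x _ =>
          hrow x (fun y => min (tensorFun μ x) (tensorFun μ y) * (F x - F y) ^ 2)
    _ = 1 / (2 * K) * ∑ j : Fin K, ∑ x : Fin (K + 1) → S,
          min (tensorFun μ x) (tensorFun μ (x ∘ levelSwap j)) * (F x - F (x ∘ levelSwap j)) ^ 2 := by
        rw [Finset.sum_comm]
        simp_rw [← Finset.mul_sum]
        rw [← mul_assoc]
        congr 1
        ring

/-- **The exact swap Dirichlet form of the profile count: `𝓔_{Sw}(G_a) = (2K)⁻¹·Σ_j (a_j − a_{j+1})²·E_j(A)`** with the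
accepted disagreement mass `E_j(A) = Σ_x min{π̃(x), π̃(x∘σ_j)}(1_{Aᶜ}(x_j) − 1_{Aᶜ}(x_{j+1}))²`. [ours] -/
theorem ptBare_dirichletForm_swap_profileCount_eq (hμ : ∀ k x, 0 < μ k x) (hμ1 : ∀ k, ∑ u, μ k u = 1)
    (a : Fin (K + 1) → ℝ) (A : Finset S) :
    dirichletForm (tensorFun μ) (ptBareSwap μ) (fun x => ∑ k, a k * bottleneckTestFun (μ k) A (x k))
      = 1 / (2 * K) * ∑ j : Fin K, (a j.castSucc - a j.succ) ^ 2
          * ∑ x : Fin (K + 1) → S, min (tensorFun μ x) (tensorFun μ (x ∘ levelSwap j))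
            * ((if x j.castSucc ∈ A then (0 : ℝ) else 1) - (if x j.succ ∈ A then (0 : ℝ) else 1)) ^ 2 := by
  rw [ptBare_dirichletForm_swap_eq hμ]
  congr 1
  refine sum_congr rfl fun j _ => ?_
  rw [Finset.mul_sum]
  refine sum_congr rfl fun x _ => ?_
  simp only [Function.comp_apply]
  rw [profileCount_sub_swap hμ1 a A x j]
  ring

/-- **`E_j(A) ≤ α_j`:** the accepted disagreement mass is at most the stationary swap acceptance `ptFinAcc μ j`.
[ours] -/
theorem acceptedDisagreement_le_acc (hμ : ∀ k x, 0 < μ k x) (A : Finset S) (j : Fin K) :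
    ∑ x : Fin (K + 1) → S, min (tensorFun μ x) (tensorFun μ (x ∘ levelSwap j))
        * ((if x j.castSucc ∈ A then (0 : ℝ) else 1) - (if x j.succ ∈ A then (0 : ℝ) else 1)) ^ 2
      ≤ ptFinAcc μ j := by
  unfold ptFinAcc
  refine sum_le_sum fun x _ => ?_
  have hmin : 0 ≤ min (tensorFun μ x) (tensorFun μ (x ∘ levelSwap j)) :=
    le_min (tensorFun_pos hμ _).le (tensorFun_pos hμ _).le
  have hsq : ((if x j.castSucc ∈ A then (0 : ℝ) else 1) - (if x j.succ ∈ A then (0 : ℝ) else 1)) ^ 2 ≤ 1 := by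
    split_ifs <;> norm_num
  calc min (tensorFun μ x) (tensorFun μ (x ∘ levelSwap j))
        * ((if x j.castSucc ∈ A then (0 : ℝ) else 1) - (if x j.succ ∈ A then (0 : ℝ) else 1)) ^ 2
      ≤ min (tensorFun μ x) (tensorFun μ (x ∘ levelSwap j)) * 1 := mul_le_mul_of_nonneg_left hsq hmin
    _ = min (tensorFun μ x) (tensorFun μ (x ∘ levelSwap j)) := mul_one _

/-- **`E_j(A) ≤ D_j(A)`:** the accepted disagreement mass is at most the disagreement mass. [ours] -/
theorem acceptedDisagreement_le_disagreement (hμ1 : ∀ k, ∑ u, μ k u = 1) (A : Finset S) (j : Fin K) :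
    ∑ x : Fin (K + 1) → S, min (tensorFun μ x) (tensorFun μ (x ∘ levelSwap j))
        * ((if x j.castSucc ∈ A then (0 : ℝ) else 1) - (if x j.succ ∈ A then (0 : ℝ) else 1)) ^ 2
      ≤ (∑ u ∈ A, μ j.castSucc u) * (∑ u ∈ Aᶜ, μ j.succ u)
          + (∑ u ∈ Aᶜ, μ j.castSucc u) * ∑ u ∈ A, μ j.succ u := by
  rw [← levelDisagreement_eq μ hμ1 A (i := j.castSucc) (l := j.succ) (ne_of_lt Fin.castSucc_lt_succ)]
  exact sum_le_sum fun x _ => mul_le_mul_of_nonneg_right (min_le_left _ _) (sq_nonneg _)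

/-! ## §2 The profile ceiling with acceptances -/

/-- **THE PROFILE CEILING WITH ACCEPTANCES:**
`Gap(ptBareSampler t μ M) ≤ [t·(2K)⁻¹·Σ_j (a_j − a_{j+1})²·E_j(A) + (1−t)·(K+1)⁻¹·Σ_k a_k²·Q_k(A,Aᶜ)]
/ Σ_k a_k²·μ_k(A)μ_k(Aᶜ)` (`0 ≤ t ≤ 1`, `|S| ≥ 2`, `Σ_k a_k²μ_k(A)μ_k(Aᶜ) > 0`). [ours] -/
theorem ptBare_spectralGap_le_profile_acc [Nontrivial S] (hμ : ∀ k x, 0 < μ k x) (hμ1 : ∀ k, ∑ u, μ k u = 1)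
    (hM : ∀ k, IsRowStochastic (M k)) (hMrev : ∀ k, DetailedBalance (μ k) (M k)) (ht0 : 0 ≤ t) (ht1 : t ≤ 1)
    (a : Fin (K + 1) → ℝ) (A : Finset S) (hA : 0 < ∑ k, a k ^ 2 * ((∑ u ∈ A, μ k u) * ∑ u ∈ Aᶜ, μ k u)) :
    spectralGap (tensorFun μ) (ptBareSampler t μ M)
      ≤ (t * (1 / (2 * K) * ∑ j : Fin K, (a j.castSucc - a j.succ) ^ 2
            * ∑ x : Fin (K + 1) → S, min (tensorFun μ x) (tensorFun μ (x ∘ levelSwap j))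
              * ((if x j.castSucc ∈ A then (0 : ℝ) else 1) - (if x j.succ ∈ A then (0 : ℝ) else 1)) ^ 2)
          + (1 - t) * (1 / (K + 1) * ∑ k, a k ^ 2 * edgeMeasure (μ k) (M k) A Aᶜ))
        / ∑ k, a k ^ 2 * ((∑ u ∈ A, μ k u) * ∑ u ∈ Aᶜ, μ k u) := by
  have hP := ptBareSampler_isRowStochastic (M := M) hμ hM ht0 ht1
  have hDB := ptBareSampler_detailedBalance (t := t) (M := M) hμ hMrev
  have hray := LevinPeres2017_lemma_13_7_rayleigh (tensorFun_pos hμ) (sum_tensorFun_eq_one μ hμ1) hP hDB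
    (ptBare_mean_profileCount (μ := μ) hμ1 a A)
  rw [ptBare_piInner_profileCount hμ1 a A, ptBare_dirichletForm_split,
    ptBare_dirichletForm_update_profileCount hμ1 hM hMrev a A,
    ptBare_dirichletForm_swap_profileCount_eq hμ hμ1 a A] at hray
  rw [le_div_iff₀ hA]
  exact hray

/-- **THE LINEAR PROFILE WITH ACCEPTANCES:** if `E_j(A) ≤ e` for every adjacent pair and `μ_k(A)μ_k(Aᶜ) ≥ v > 0`
at every level `k ≥ 1` (`K ≥ 1`), then whatever the hot update `M_0` is,
`Gap(ptBareSampler t μ M) ≤ 6·(t·e/2 + (1−t)·(K+1)⁻¹·Σ_k k²·Q_k(A,Aᶜ))/(v·K(K+1)(2K+1))`. [ours] -/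
theorem ptBareLinearAcc_spectralGap_le [Nontrivial S] (hK : 1 ≤ K) (hμ : ∀ k x, 0 < μ k x)
    (hμ1 : ∀ k, ∑ u, μ k u = 1) (hM : ∀ k, IsRowStochastic (M k)) (hMrev : ∀ k, DetailedBalance (μ k) (M k))
    (ht0 : 0 ≤ t) (ht1 : t ≤ 1) (A : Finset S) {e v : ℝ} (hvpos : 0 < v)
    (he : ∀ j : Fin K, ∑ x : Fin (K + 1) → S, min (tensorFun μ x) (tensorFun μ (x ∘ levelSwap j))
      * ((if x j.castSucc ∈ A then (0 : ℝ) else 1) - (if x j.succ ∈ A then (0 : ℝ) else 1)) ^ 2 ≤ e)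
    (hv : ∀ k : Fin (K + 1), k ≠ 0 → v ≤ (∑ u ∈ A, μ k u) * ∑ u ∈ Aᶜ, μ k u) :
    spectralGap (tensorFun μ) (ptBareSampler t μ M)
      ≤ 6 * (t * (e / 2) + (1 - t) * (1 / (K + 1) * ∑ k : Fin (K + 1), ((k : ℕ) : ℝ) ^ 2
          * edgeMeasure (μ k) (M k) A Aᶜ)) / (v * ((K : ℝ) * (K + 1) * (2 * K + 1))) := by
  have hKpos : (0 : ℝ) < K := Nat.cast_pos.mpr (by omega)
  have hnorm := linearProfile_norm_ge (μ := μ) A hv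
  have hS : 0 < v * ((K : ℝ) * (K + 1) * (2 * K + 1) / 6) := by positivity
  have hA : 0 < ∑ k : Fin (K + 1), ((k : ℕ) : ℝ) ^ 2 * ((∑ u ∈ A, μ k u) * ∑ u ∈ Aᶜ, μ k u) :=
    lt_of_lt_of_le hS hnorm
  have hmain := ptBare_spectralGap_le_profile_acc (t := t) (M := M) hμ hμ1 hM hMrev ht0 ht1
    (fun k : Fin (K + 1) => ((k : ℕ) : ℝ)) A hA
  -- the swap term: squared gradients are one, the accepted disagreement masses are `≤ e`
  have hone : ∀ j : Fin K, ((((j.castSucc : Fin (K + 1)) : ℕ) : ℝ) - (((j.succ : Fin (K + 1)) : ℕ) : ℝ)) ^ 2 = 1 := by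
    intro j; simp only [Fin.val_castSucc, Fin.val_succ]; push_cast; ring
  have hswap : 1 / (2 * K) * ∑ j : Fin K, ((((j.castSucc : Fin (K + 1)) : ℕ) : ℝ) - (((j.succ : Fin (K + 1)) : ℕ) : ℝ)) ^ 2
        * ∑ x : Fin (K + 1) → S, min (tensorFun μ x) (tensorFun μ (x ∘ levelSwap j))
          * ((if x j.castSucc ∈ A then (0 : ℝ) else 1) - (if x j.succ ∈ A then (0 : ℝ) else 1)) ^ 2
      ≤ e / 2 := by
    simp_rw [hone, one_mul]
    have hsum : ∑ j : Fin K, ∑ x : Fin (K + 1) → S, min (tensorFun μ x) (tensorFun μ (x ∘ levelSwap j))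
          * ((if x j.castSucc ∈ A then (0 : ℝ) else 1) - (if x j.succ ∈ A then (0 : ℝ) else 1)) ^ 2 ≤ K * e :=
      (sum_le_sum fun j _ => he j).trans
        (by rw [Finset.sum_const, Finset.card_univ, Fintype.card_fin, nsmul_eq_mul])
    calc 1 / (2 * K) * ∑ j : Fin K, ∑ x : Fin (K + 1) → S, min (tensorFun μ x) (tensorFun μ (x ∘ levelSwap j))
            * ((if x j.castSucc ∈ A then (0 : ℝ) else 1) - (if x j.succ ∈ A then (0 : ℝ) else 1)) ^ 2
        ≤ 1 / (2 * K) * (K * e) := mul_le_mul_of_nonneg_left hsum (by positivity)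
      _ = e / 2 := by
          rw [div_mul_eq_mul_div, one_mul, div_eq_div_iff (by positivity) (by norm_num)]
          ring
  have hQ : 0 ≤ (1 - t) * (1 / (K + 1) * ∑ k : Fin (K + 1), ((k : ℕ) : ℝ) ^ 2 * edgeMeasure (μ k) (M k) A Aᶜ) :=
    mul_nonneg (by linarith) (mul_nonneg (by positivity) (sum_nonneg fun k _ => mul_nonneg (sq_nonneg _)
      (sum_nonneg fun x _ => sum_nonneg fun y _ => mul_nonneg (hμ k x).le ((hM k).1 x y))))
  have he0 : 0 ≤ e := le_trans (sum_nonneg fun x _ => mul_nonneg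
    (le_min (tensorFun_pos hμ _).le (tensorFun_pos hμ _).le) (sq_nonneg _)) (he ⟨0, hK⟩)
  have hnum : t * (1 / (2 * K) * ∑ j : Fin K,
          ((((j.castSucc : Fin (K + 1)) : ℕ) : ℝ) - (((j.succ : Fin (K + 1)) : ℕ) : ℝ)) ^ 2
          * ∑ x : Fin (K + 1) → S, min (tensorFun μ x) (tensorFun μ (x ∘ levelSwap j))
            * ((if x j.castSucc ∈ A then (0 : ℝ) else 1) - (if x j.succ ∈ A then (0 : ℝ) else 1)) ^ 2)
        + (1 - t) * (1 / (K + 1) * ∑ k : Fin (K + 1), ((k : ℕ) : ℝ) ^ 2 * edgeMeasure (μ k) (M k) A Aᶜ)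
      ≤ t * (e / 2)
        + (1 - t) * (1 / (K + 1) * ∑ k : Fin (K + 1), ((k : ℕ) : ℝ) ^ 2 * edgeMeasure (μ k) (M k) A Aᶜ) := by
    have := mul_le_mul_of_nonneg_left hswap ht0
    linarith
  have hnum0 : 0 ≤ t * (e / 2)
      + (1 - t) * (1 / (K + 1) * ∑ k : Fin (K + 1), ((k : ℕ) : ℝ) ^ 2 * edgeMeasure (μ k) (M k) A Aᶜ) :=
    add_nonneg (by positivity) hQ
  calc spectralGap (tensorFun μ) (ptBareSampler t μ M)
      ≤ _ := hmain
    _ ≤ (t * (e / 2)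
          + (1 - t) * (1 / (K + 1) * ∑ k : Fin (K + 1), ((k : ℕ) : ℝ) ^ 2 * edgeMeasure (μ k) (M k) A Aᶜ))
        / ∑ k : Fin (K + 1), ((k : ℕ) : ℝ) ^ 2 * ((∑ u ∈ A, μ k u) * ∑ u ∈ Aᶜ, μ k u) :=
        div_le_div_of_nonneg_right hnum hA.le
    _ ≤ (t * (e / 2)
          + (1 - t) * (1 / (K + 1) * ∑ k : Fin (K + 1), ((k : ℕ) : ℝ) ^ 2 * edgeMeasure (μ k) (M k) A Aᶜ))
        / (v * ((K : ℝ) * (K + 1) * (2 * K + 1) / 6)) :=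
        div_le_div_of_nonneg_left hnum0 hS hnorm
    _ = 6 * (t * (e / 2) + (1 - t) * (1 / (K + 1) * ∑ k : Fin (K + 1), ((k : ℕ) : ℝ) ^ 2
          * edgeMeasure (μ k) (M k) A Aᶜ)) / (v * ((K : ℝ) * (K + 1) * (2 * K + 1))) := by
        rw [div_eq_div_iff (by positivity) (by positivity)]
        ring

/-- **FEW REPLICAS OR MANY, REPLICA EXCHANGE PAYS:** if no replica at a level `k ≥ 1` crosses the sector on its own
(`Q_k(A,Aᶜ) = 0`; the hot update `M_0` arbitrary), every swap acceptance is `α_j ≤ α`, and `μ_k(A)μ_k(Aᶜ) ≥ v > 0`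
for `k ≥ 1`, then `Gap(ptBareSampler t μ M) ≤ 3tα/(v·K(K+1)(2K+1))` — relaxation `≥ v·K(K+1)(2K+1)/(3tα)` steps.
[ours] -/
theorem ptBareFrozenSectorAcc_spectralGap_le [Nontrivial S] (hK : 1 ≤ K) (hμ : ∀ k x, 0 < μ k x)
    (hμ1 : ∀ k, ∑ u, μ k u = 1) (hM : ∀ k, IsRowStochastic (M k)) (hMrev : ∀ k, DetailedBalance (μ k) (M k))
    (ht0 : 0 ≤ t) (ht1 : t ≤ 1) (A : Finset S) {α v : ℝ} (hvpos : 0 < v)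
    (hα : ∀ j : Fin K, ptFinAcc μ j ≤ α)
    (hv : ∀ k : Fin (K + 1), k ≠ 0 → v ≤ (∑ u ∈ A, μ k u) * ∑ u ∈ Aᶜ, μ k u)
    (hfrozen : ∀ k : Fin (K + 1), k ≠ 0 → edgeMeasure (μ k) (M k) A Aᶜ = 0) :
    spectralGap (tensorFun μ) (ptBareSampler t μ M) ≤ 3 * t * α / (v * ((K : ℝ) * (K + 1) * (2 * K + 1))) := by
  have h := ptBareLinearAcc_spectralGap_le (t := t) (M := M) hK hμ hμ1 hM hMrev ht0 ht1 A hvpos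
    (fun j => (acceptedDisagreement_le_acc hμ A j).trans (hα j)) hv
  have hQ0 : ∑ k : Fin (K + 1), ((k : ℕ) : ℝ) ^ 2 * edgeMeasure (μ k) (M k) A Aᶜ = 0 := by
    refine Finset.sum_eq_zero fun k _ => ?_
    by_cases hk : k = 0
    · subst hk; simp
    · rw [hfrozen k hk, mul_zero]
  rw [hQ0, mul_zero, mul_zero, add_zero] at h
  calc spectralGap (tensorFun μ) (ptBareSampler t μ M) ≤ _ := h
    _ = 3 * t * α / (v * ((K : ℝ) * (K + 1) * (2 * K + 1))) := by ring

/-- **TOO FEW REPLICAS OVER THE WINDOW:** if no replica at a level `k ≥ 1` crosses the sector, `μ_k(A)μ_k(Aᶜ) ≥ v > 0`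
(`k ≥ 1`), and every adjacent pair is `ε`-SEPARATED by a test set `B_j` — level `j` puts mass `≤ ε` in `B_j`, level
`j+1` puts mass `≤ ε` outside `B_j` (for tempering in a coupling: `B_j` = "action below a threshold between the two
typical values") — then every swap acceptance is `≤ 2ε` and `Gap(ptBareSampler t μ M) ≤ 6tε/(v·K(K+1)(2K+1))`.
[ours] -/
theorem ptBareFrozenSectorSeparated_spectralGap_le [Nontrivial S] (hK : 1 ≤ K) (hμ : ∀ k x, 0 < μ k x)
    (hμ1 : ∀ k, ∑ u, μ k u = 1) (hM : ∀ k, IsRowStochastic (M k)) (hMrev : ∀ k, DetailedBalance (μ k) (M k))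
    (ht0 : 0 ≤ t) (ht1 : t ≤ 1) (A : Finset S) {v ε : ℝ} (hvpos : 0 < v) (B : Fin K → Finset S)
    (hout : ∀ j : Fin K, ∑ u ∈ B j, μ j.castSucc u ≤ ε) (hin : ∀ j : Fin K, ∑ u ∈ (B j)ᶜ, μ j.succ u ≤ ε)
    (hv : ∀ k : Fin (K + 1), k ≠ 0 → v ≤ (∑ u ∈ A, μ k u) * ∑ u ∈ Aᶜ, μ k u)
    (hfrozen : ∀ k : Fin (K + 1), k ≠ 0 → edgeMeasure (μ k) (M k) A Aᶜ = 0) :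
    spectralGap (tensorFun μ) (ptBareSampler t μ M) ≤ 6 * t * ε / (v * ((K : ℝ) * (K + 1) * (2 * K + 1))) := by
  have hα : ∀ j : Fin K, ptFinAcc μ j ≤ 2 * ε := by
    intro j
    refine (ptFinAcc_le_separation hμ hμ1 j (B j)).trans ?_
    have hc1 : ∑ u ∈ B j, μ j.castSucc u + ∑ u ∈ (B j)ᶜ, μ j.castSucc u = 1 := by
      rw [Finset.sum_add_sum_compl, hμ1]
    have hc2 : ∑ u ∈ B j, μ j.succ u + ∑ u ∈ (B j)ᶜ, μ j.succ u = 1 := by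
      rw [Finset.sum_add_sum_compl, hμ1]
    have h1 : 0 ≤ ∑ u ∈ B j, μ j.castSucc u := sum_nonneg fun u _ => (hμ _ u).le
    have h2 : 0 ≤ ∑ u ∈ (B j)ᶜ, μ j.succ u := sum_nonneg fun u _ => (hμ _ u).le
    have h3 : 0 ≤ ∑ u ∈ (B j)ᶜ, μ j.castSucc u := sum_nonneg fun u _ => (hμ _ u).le
    have h4 : 0 ≤ ∑ u ∈ B j, μ j.succ u := sum_nonneg fun u _ => (hμ _ u).le
    nlinarith [hout j, hin j, mul_nonneg h3 h4, mul_nonneg h1 h2]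
  have h := ptBareFrozenSectorAcc_spectralGap_le (t := t) (M := M) hK hμ hμ1 hM hMrev ht0 ht1 A hvpos hα hv hfrozen
  calc spectralGap (tensorFun μ) (ptBareSampler t μ M) ≤ _ := h
    _ = 6 * t * ε / (v * ((K : ℝ) * (K + 1) * (2 * K + 1))) := by ring

end Summit.Ventures.LatticeQCDFlow.Scaling

end
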